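import Summits.SmoothPoincare4.SmoothPoincare4.Theses.EntropyRung
import Summits.SmoothPoincare4.SmoothPoincare4.Theses.WeylBudget
import Literature.Geometry.Riemannian.ChangGurskyYangProofs
import Literature.Geometry.Riemannian.HamiltonCurvatureODE
import Literature.Geometry.Riemannian.CkNecks
import Literature.Geometry.Riemannian.CanonicalNeighbourhoods
import Literature.Geometry.Riemannian.RicciFlowMaximal
import Literature.Geometry.Riemannian.HamiltonPCOClassificationKillingHopf
import Summits.SmoothPoincare4.SmoothPoincare4.Theorems.ChangGurskyYang.Negative.WithoutCompactFalse
import Summits.SmoothPoincare4.SmoothPoincare4.Theorems.ChangGurskyYang.Negative.WithoutSimplyConnectedFalse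
import HarnessLib
import HarnessLib.Audit

/-!
# Line `neck-exclusion` for crux `EntropyRung.ChangGurskyYang` (stmt-SmoothPoincare4-10834)

Planner skeleton (crux-plan, round 1; planner-cruxplan-stmt-SmoothPoincare4-10834-neck-exclusion-0,
2026-08-16) of idea card `Cruxes/ChangGurskyYang/Ideas/neck-exclusion.md` (ideator 2; triage r1:
pass ×3, "CN-theorem-priced alternative endgame"). Line card: `Lines/neck-exclusion.md`.

The crux is VERBATIM the named fact `changGurskyYang_sphere_four` (CGY 2003 Thm. A, simply
connected `scal > 0` case; `Disproof.crux_iff_fact`). Every line is therefore a PROOF ARCHITECTURE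
for the three leaves `hThm14` / `hCGB` / `hMargerin` of the tree's kernel-checked reduction
`changGurskyYang_sphere_four_of_margerin_of_chernGaussBonnet_of_thm14`. THIS line re-cuts
MARGERIN'S LEAF (`R > 0`, `WP < 1/6` pointwise on a closed simply connected `M⁴` ⇒ `M ≅ S⁴`)
inside the 4-d PIC Ricci-flow programme, with NO pinching improvement and NO Hamilton-1982/86
convergence theory for Margerin's pinching family:

  `WP := (|W|² + 2|E|²)/R²` is scale-invariant, continuous in the 2-jet of the metric, EXACTLY
  `1/6` on every `S³×ℝ`-shaped curvature operator, and its round sub-level cones `WP ≤ c₀`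
  (`c₀ < 1/6`; block form `margerinCone (4c₀)`) are forward-invariant under Hamilton's ODE
  (Margerin 1998 Prop. 4 at `β = 2` — the QUALITATIVE half only). Hence `max WP = c₀ < 1/6`
  propagates along the Ricci flow (tensor maximum principle); `WP < 1/6 ⇒ PIC`; at the first
  singular time the (C^{[1/ε]}) canonical neighbourhood of a high-curvature point is neither an
  `ε`-neck nor an `ε`-cap (both contain a C²-`ε`-neck, on which some point has `WP ≥ 1/6 − δ > c₀`),
  so it is the third alternative: a compact piece with positive curvature operator, i.e. all of the
  connected `M`; Hamilton 1986 gives `S⁴ ∨ ℝP⁴` and `π₁ = 1` discards `ℝP⁴`.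

## Chain (composition `ChangGurskyYang_of`, kernel-checked below, no `sorry` outside `stub_*`)

  crux hypotheses (`M` closed simply connected, `g` Riemannian, `R > 0`, `∫|W|² < 32π²`)
  —[stub_pointwisePinching = CGY Thm 1.4 (α = 1) + Chern–Gauss–Bonnet + χ ≥ 2; the tree's
    `hPointwise` VERBATIM]→ `g'` Riemannian, `R > 0`, `σ₂(A) − ¼|W|² > 0` in every frame
  —[tree: `weakPinching_lt_iff`, `IsOrthonormalFrame.weakPinching_of_sigma2_sub_pos`]→ `WP < 1/6`
  —[stub_thirdAlternative, fed with stub_neckWP, (stub_wpPropagation stub_coneInvariant) and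
    stub_ckDichotomy]→ a Riemannian metric on `M` with positive curvature operator
  —[stub_hamiltonConvergence = Hamilton 1986 convergence (H1); tree: + Killing–Hopf (H2, PROVED)
    = `hamilton_positiveCurvatureOperator_classification_four`, + `π₁(ℝP⁴) ≠ 1`
    (`hamilton_positiveCurvatureOperator_sphere_four_of_classification`)]→ `M ≅ S⁴`.

## Stubs (7, registered; sizes are guesses; "modulo" = unproved named facts of the tree)

* `stub_pointwisePinching` — XL, SHARED leaf (= `Thm14LeafPsc` + `CGBLeaf` of Disproof §7; the GV
  cards' `thm14_gurskyViaclovsky` closes its hard half). Not this line's business.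
* `stub_coneInvariant` — L, THE LINE'S ALGEBRAIC CORE (Margerin 1998 Prop. 4 / Prop. 28 at β = 2,
  block form; numerically certified by kit j008125, j010008, j010014; kernel calibration
  `IdeasSketchR1K2.rigidRays_contact`). HARDEST STUB (lead).
* `stub_wpPropagation` — M modulo `hamilton_maximumPrinciple_curvatureODE` (+ the blocks ↔ `|W|²`,
  `|E|²` dictionary, half of which is `weylNormSqFrame_eq_hamiltonBlocks`, proved).
* `stub_neckWP` — L, soft (curvature is continuous in the 2-jet; `WP(S³×ℝ) = 1/6`); second hardest.
* `stub_ckDichotomy` — XL as literature, M as plumbing: the C^{[1/ε]} shadow of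
  `chenZhu_aprioriAssumptions_smoothSolution` (whose C⁰ form is PROVED in the tree from Thm 4.1 +
  NLC + Lemma 2.1 + PIC preservation + regularity); needs the C^k form of the named fact
  `chenZhu_canonicalNeighbourhoodTheorem` (an UPGRADE of an existing fact to its printed strength)
  and a C^k cap notion — THE BET OF THE LINE.
* `stub_thirdAlternative` — M/L modulo `ricciFlow_maximal_existence` + `ricciFlow_curvature_blowup`
  (everything else it uses is proved: `IsRicciFlow.singularTime_le`, `scalarCurvature_pos`,
  `exists_isMaximalRicciFlow_one_lt_of_isMaximalRicciFlow`, `weakPinching_constSmul`,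
  `sq_scalarCurvature_sub_three_mul_isotropicCurvature_le`, `hasPositiveCurvatureOperatorOn_univ_iff`).
* `stub_hamiltonConvergence` — XL citation: Hamilton 1986 Thm 1.1, CONVERGENCE HALF (H1: PCO ⇒ a
  metric of constant positive sectional curvature), VERBATIM the hypothesis `h₁` of the tree's
  `hamilton_positiveCurvatureOperator_classification_four_of_constantCurvature` (H2 Killing–Hopf
  is PROVED there); shared with routes ExoticMirrors / AngleDefectCertificates and the sibling
  cards' "criterion 5.2" node.

## Disproof used (`Cruxes/ChangGurskyYang/Disproof.lean`, cdisprove v4, re-read 2026-08-16)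

* §0 `crux_iff_fact`: the composition targets `EntropyRung.ChangGurskyYang` BY NAME.
* §3a `changGurskyYang_false_without_compact` (LANDED, imported above): honoured —
  `[CompactSpace M]` is a binder of `stub_pointwisePinching`, `stub_wpPropagation` (max principle
  on a closed manifold), `stub_ckDichotomy` (NLC, CN theorem, blow-up: closed `M`),
  `stub_thirdAlternative` (`T ≤ 2/R_min`, clopen `B = M`) and `stub_hamiltonConvergence`; the punctured sphere
  never enters (its flow is immortal and nothing concentrates).
* §3b `changGurskyYang_false_without_simplyConnected` (LANDED, imported above): honoured —
  `π₁ = 1` is used in `stub_ckDichotomy` (the CN theorem is vendored for simply connected `M`: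
  no quotient necks) and in the composition to discard `ℝP⁴`
  (`hamilton_positiveCurvatureOperator_sphere_four_of_classification`). No stub concludes anything
  about a non-simply-connected `M` except `stub_hamiltonConvergence`, whose conclusion (a constant
  curvature metric) is true on `ℝP⁴`; the `∨ ℝP⁴` exit is the tree's Killing–Hopf theorem.
* §7 `thm14Leaf_false` (PAPER): `hThm14` verbatim is NOT registered; `stub_pointwisePinching` is the
  tree's `hPointwise`, whose `M` is simply connected (hence connected) — immune. `MargerinLeafNonStrict`
  PAPER-false (`S³×S¹`, `ℂP²` at `WP ≡ 1/6`): honoured — every WP hypothesis here is STRICT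
  (`< 1/6`, resp. `≤ c₀ < 1/6`); the margin `1/6 − c₀` is exactly what `stub_neckWP` consumes.
* §4 `ChangGurskyYangBelow c` PAPER-false for `c > 48π²`, §3d `WithoutWeylBound` PAPER-false:
  the Weyl bound enters once, through `stub_pointwisePinching`; `(ℂP², g_FS)` has `WP ≡ 1/6`.
* §5/§3d junk probes: every stub carries `IsRiemannian`; `weakPinching` is only evaluated where
  `R > 0` is in force.
* Negatives index (`ledger negatives --problem SmoothPoincare4`): see line card; no stub is an
  instance of a refuted statement.
-/

noncomputable section

open scoped Manifold ContDiff ENNReal Matrix BigOperators Topology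
open Set

namespace Summit.SmoothPoincare4.SmoothPoincare4.Cruxes.ChangGurskyYang.NeckExclusion

set_option linter.dupNamespace false

open Literature.Geometry.Riemannian
open Literature.Geometry.Riemannian.HamiltonODE
open Literature.Geometry.Lorentzian (PseudoRiemannianMetric)
open Literature.Geometry.Lorentzian.PseudoRiemannianMetric

/-- Local notation: the standard `S⁴ ⊂ ℝ⁵`. -/
local notation "𝕊⁴" => (Metric.sphere (0 : EuclideanSpace ℝ (Fin 5)) 1)

/-! ## Objects of the line: Margerin's weak-pinching cone in Hamilton's block space

(Verbatim from the ideator's checked sketch `Cruxes/ChangGurskyYang/IdeasSketchR1K2.lean`, the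
typing all three triagers certified: symmetric `A`, `C`, Bianchi locus `tr A = tr C`, `tr A ≥ 0`;
the unconstrained typing of `SketchIdeator3` is refuted, `TriageR1K3Witness.lean`.) To be re-homed by
the lead in a Theorems defs file (definition items filed by the planner, see the line card). -/

/-- Frobenius square norm of a `3 × 3` block. -/
def frob (X : Matrix (Fin 3) (Fin 3) ℝ) : ℝ := ∑ i, ∑ j, X i j ^ 2

/-- Traceless Frobenius mass `‖Å‖² + 2‖B‖² + ‖C̊‖²` of a block triple; for the blocks of a
Riemannian 4-metric in an orthonormal frame (`tr A = tr C = R/2`) this is `Σ W² + 2 Σ E²`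
(`(0,4)`-norms of CGY 2003, Remark 2; `Σ W² = ‖Å‖² + ‖C̊‖²` is the tree theorem
`weylNormSqFrame_eq_hamiltonBlocks`). -/
def tracelessMass (p : Blocks) : ℝ :=
  frob (p.1 - (p.1.trace / 3) • (1 : Matrix (Fin 3) (Fin 3) ℝ)) + 2 * frob p.2.1 +
    frob (p.2.2 - (p.2.2.trace / 3) • (1 : Matrix (Fin 3) (Fin 3) ℝ))

/-- **Margerin's round cone** `WP ≤ k/4` in block form: `A`, `C` symmetric, `tr A = tr C ≥ 0`
(Bianchi locus, `= R/2`), `‖Å‖² + 2‖B‖² + ‖C̊‖² ≤ k (tr A)²`. `k = 2/3` is weak pinching `≤ 1/6`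
(`S³ × ℝ` and `ℂP²` lie on its boundary: `IdeasSketchR1K2.rigidRays_contact`); `k = 0` is the
constant-curvature ray. Closed, convex (a second-order cone over the seminorm `√tracelessMass`),
symmetric under `B ↦ -B`. [cite: Margerin1998, Part I, p. 25 and Prop. 4] -/
def margerinCone (k : ℝ) : Set Blocks :=
  {p | p.1.IsSymm ∧ p.2.2.IsSymm ∧ p.1.trace = p.2.2.trace ∧ 0 ≤ p.1.trace ∧
    tracelessMass p ≤ k * p.1.trace ^ 2}

/-! ## Registered stubs (the only `sorry`s of the line) -/

/-- **stub_pointwisePinching** — integral ⇒ pointwise pinching (Chang–Gursky–Yang 2003, §1–§2: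
Thm. 1.4 with `α = 1`, after (0.3) ⇒ (1.2) by Chern–Gauss–Bonnet (1.1) and `χ(M) = 2 + b₂ ≥ 2`).
VERBATIM the hypothesis `hPointwise` of the tree's reduction
`changGurskyYang_sphere_four_of_margerin_of_pointwisePinching`: on a closed simply connected `M⁴`,
a Riemannian `g` with `R > 0` and `∫|W|² < 32π²` yields a Riemannian `g'` with `R > 0` and
`¼|W|² < σ₂(A)` in every orthonormal frame. [XL; SHARED leaf = `CGBLeaf` + `Thm14LeafPsc` of
Disproof §7 (its `M` is simply connected, hence connected: immune to `thm14Leaf_false`); the GV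
cards (`gv-continuity-path`) own the Thm-1.4 half. Leans on (names): `sigma2WeylSchoutenFrame`,
`weylNormSqFrame`, `weylEnergy`, `chernGaussBonnet_four` (unproved fact), `Thm14LeafPsc`.]
[cite: ChangGurskyYang2003, Thm. 1.4 and §2, p. 121] -/
theorem stub_pointwisePinching :
    ∀ (M : Type) [TopologicalSpace M] [T2Space M] [SecondCountableTopology M]
      [ChartedSpace (EuclideanSpace ℝ (Fin 4)) M] [IsManifold (𝓡 4) ∞ M] [CompactSpace M]
      [SimplyConnectedSpace M]
      (g : PseudoRiemannianMetric (𝓡 4) ∞ (EuclideanSpace ℝ (Fin 4)) (TangentSpace (𝓡 4) : M → Type _))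
      [g.HasLeviCivita], g.IsRiemannian → (∀ x, 0 < g.scalarCurvature x) →
      g.weylEnergy < ENNReal.ofReal (32 * Real.pi ^ 2) →
      ∃ (g' : PseudoRiemannianMetric (𝓡 4) ∞ (EuclideanSpace ℝ (Fin 4)) (TangentSpace (𝓡 4) : M → Type _))
        (_ : g'.HasLeviCivita), g'.IsRiemannian ∧ (∀ x, 0 < g'.scalarCurvature x) ∧
        ∀ (x : M) (e : Fin 4 → TangentSpace (𝓡 4) x), g'.IsOrthonormalFrame x e →
          1 / 4 * g'.weylNormSqFrame x e < g'.sigma2WeylSchoutenFrame x e := by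
  sorry

/-- **stub_coneInvariant** — MARGERIN'S CONE INVARIANCE AT `β = 2` (Margerin 1998, Prop. 4 /
Lemma 9 hypothesis at `β = 2`, Prop. 28 for the zero set): every round cone `WP ≤ k/4` with
`0 ≤ k < 2/3` (i.e. `c₀ = k/4 < 1/6`) is forward-invariant under Hamilton's block ODE
`A' = A² + BᵗB + 2A^#, B' = AB + BC + 2B^#, C' = C² + ᵗBB + 2C^#` (`HamiltonODE.field`).
Proof route: the fundamental polynomial `P₂ = t⟨M, field M⟩ − (t² + ‖B‖²)‖M‖²` (`t = tr A`;
`sign P₂ = sign d/dτ WP`) is STRICTLY negative on `∂C(k) ∖ {0}` for `0 < k < 2/3` (binding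
direction the neck ray, value `−2b²(1−3b)²`, `b = √(k/6) < ⅓`: kit j008125/j010008/j010014,
three independent codes; Margerin p. 27 "negative on any more pinched curvature"), the Bianchi
locus `{A, C symmetric, tr A = tr C}` and `{tr A ≥ 0}` are invariant (`(tr A)' = (tr A)² + ‖B‖²`),
and an exit-time argument closes (at `0`, the only cone point with `tr A = 0`, the quadratic field
keeps the solution at `0`). `k = 0` is the constant-curvature ray (invariant). Only `k < 2/3` is
stated — all the line uses (triage r1-1 sharpen); the closed `1/6`-cone is invariant too but only
via Nagumo (contact on the rigid rays, `IdeasSketchR1K2.rigidRays_contact`). [L; HARDEST STUB;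
provable now: one quartic inequality in 21 variables (13 after `O(3)×O(3)`) + ODE comparison.
Leans on: `HamiltonODE.isInvariant_iff`, `IsSolutionOn`, `Matrix.sharp`, Mathlib ODE/Gronwall.]
[cite: Margerin1998, Prop. 4, Lemma 9, Prop. 28] -/
theorem stub_coneInvariant :
    ∀ k : ℝ, 0 ≤ k → k < 2 / 3 → IsInvariant field (fun _ ↦ margerinCone k) := by
  sorry

/-- **stub_wpPropagation** — THE CONE RIDES THE RICCI FLOW (Margerin 1998, Cor. 3 / p. 27: "by the
parabolic maximum principle … the maximum of the weak pinching is non-increasing"; here only below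
`1/6`): GIVEN the cone invariance, along every Ricci flow of Riemannian metrics on `[0, T)` on a
closed `4`-manifold with `R > 0` and `WP ≤ c₀` (`0 ≤ c₀ < 1/6`) at `t = 0`, one has `R > 0` and
`WP ≤ c₀` at every `t ∈ [0, T)`. Proof route: Hamilton's maximum principle for the curvature ODE
(named fact `hamilton_maximumPrinciple_curvatureODE`, with `Z t = margerinCone (4c₀)`: closed,
convex, `reflectB`-symmetric, constant track) + the dictionary "blocks of a Riemannian metric in an
orthonormal frame lie on the Bianchi locus with `tr A = tr C = R/2`, `Σ W² = ‖Å‖² + ‖C̊‖²`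
(`weylNormSqFrame_eq_hamiltonBlocks`, PROVED), `Σ E² = ‖B‖²` (to prove, same 256-term method)" +
`weakPinching_eq_of_isOrthonormalFrame` + `R > 0` preserved (`IsRicciFlow.scalarCurvature_pos`,
PROVED; compactness gives `R ≥ R_min > 0` at `t = 0`) + `IsLeviCivita.eq_leviCivita_holds` to pass
between `cov t` and `(g t).leviCivita`. [M modulo `hamilton_maximumPrinciple_curvatureODE`.]
[cite: Margerin1998, Cor. 3] [cite: Hamilton1986, §4, Thm. 4.3] -/
theorem stub_wpPropagation :
    (∀ k : ℝ, 0 ≤ k → k < 2 / 3 → IsInvariant field (fun _ ↦ margerinCone k)) →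
    ∀ (M : Type) [TopologicalSpace M] [T2Space M] [SecondCountableTopology M] [CompactSpace M]
      [ChartedSpace (EuclideanSpace ℝ (Fin 4)) M] [IsManifold (𝓡 4) ∞ M] (T : ℝ)
      (g : ℝ → PseudoRiemannianMetric (𝓡 4) ∞ (EuclideanSpace ℝ (Fin 4))
        (TangentSpace (𝓡 4) : M → Type _))
      (cov : ℝ → CovariantDerivative (𝓡 4) (EuclideanSpace ℝ (Fin 4))
        (TangentSpace (𝓡 4) : M → Type _)),
      IsRicciFlow g cov (Ico 0 T) → (∀ t ∈ Ico 0 T, (g t).IsRiemannian) →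
      ∀ c₀ : ℝ, 0 ≤ c₀ → c₀ < 1 / 6 →
      (∀ x : M, haveI := (g 0).hasLeviCivita; 0 < (g 0).scalarCurvature x) →
      (∀ x : M, haveI := (g 0).hasLeviCivita; (g 0).weakPinching x ≤ c₀) →
      ∀ t ∈ Ico 0 T, ∀ x : M, haveI := (g t).hasLeviCivita;
        0 < (g t).scalarCurvature x ∧ (g t).weakPinching x ≤ c₀ := by
  sorry

/-- **stub_neckWP** — NECKS ARE NOT WEAKLY PINCHED: for every `δ > 0` there is `ε₁ > 0` such that
every `ε`-neck (`ε ≤ ε₁`) of a Riemannian `4`-manifold in the `C^{[1/ε]}` topology (`IsCkEpsNeck 3`,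
Chen–Zhu 2006 §2 / Hamilton 1997 §3.2 (C2)) contains a point `y` with `WP(y) ≥ 1/6 − δ`.
Proof route: along the neck chart `ψ`, `h = r⁻²ψ^*g` is `ε`-close in `C^k`, `k = ⌊1/ε⌋ ≥ 2`, to
`ḡ = 6|x|⁻²δ` on the annulus; at the unit point `x₀` (`|x₀| = 1 ∈ A(ε⁻¹)`) the 2-jet of `h` is
within `C·ε` of that of `ḡ` (`D̄h`, `D̄²h` small and `Γ̄_{x₀}` fixed), curvature is a continuous
function of the 2-jet at a point where `h` is positive definite, `WP(ḡ) ≡ 1/6` (`W = 0`,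
`Ric = diag(⅓,⅓,⅓,0)`, `2|E|² = 1/6 = R²/6`), and `WP(h)(x₀) = WP(g)(ψ x₀)` (naturality under the
local diffeomorphism `ψ`, `IsNeckChart`, and scale invariance `weakPinching_constSmul`, PROVED).
[L; second hardest; soft. Leans on: `IsCkEpsNeck`, `IsCkCloseOn`, `cylTensor`, `cylCovDerivIter`,
`neckPullback`, `MetricCoord.riemAt`/`OpensChart.curvatureForm_eq_apply_riemAt` (chart curvature),
`weakPinching_constSmul`, `HasConstantSectionalCurvatureWith.weakPinching_eq_zero` as template.]
[cite: ChenZhu2006, §2, p. 4] [cite: Hamilton1997, §3.2 (C2)] [cite: Margerin1998, Part I, p. 27] -/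
theorem stub_neckWP :
    ∀ δ : ℝ, 0 < δ → ∃ ε₁ : ℝ, 0 < ε₁ ∧
      ∀ (M : Type) [TopologicalSpace M] [T2Space M] [SecondCountableTopology M]
        [ChartedSpace (EuclideanSpace ℝ (Fin 4)) M] [IsManifold (𝓡 4) ∞ M]
        (g : PseudoRiemannianMetric (𝓡 4) ∞ (EuclideanSpace ℝ (Fin 4)) (TangentSpace (𝓡 4) : M → Type _))
        [g.HasLeviCivita], g.IsRiemannian →
        ∀ (N : Set M) (ε r : ℝ), ε ≤ ε₁ → IsCkEpsNeck 3 g N ε r →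
          ∃ y ∈ N, 1 / 6 - δ ≤ g.weakPinching y := by
  sorry

/-- **stub_ckDichotomy** — THE C^{[1/ε]} CANONICAL-NEIGHBOURHOOD DICHOTOMY AT THE FIRST SINGULAR
TIME (Chen–Zhu 2006, Thm. 4.1 (p. 19) + §5, p. 26 "It follows from Lemma 2.1 and Theorem 4.1 that
the a priori assumptions hold for the smooth solution on `[0, T₀)`", with the PRINTED `C^{[ε⁻¹]}`
necks of §2, p. 4 and the caps of §4, p. 24): for all small accuracies `0 < ε ≤ ε₀`, for every
maximal Ricci flow on a closed SIMPLY CONNECTED `4`-manifold with `T > 1` and PIC initial metric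
there is `r > 0` such that at every `(x, t)` with `R(x, t) ≥ r⁻²` EITHER `(M, g(t))` contains a
`C^{[1/ε]}` `ε`-neck (alternatives (a): the time-`t` slice of a strong `ε`-neck,
`IsCkStrongEpsNeck.isCkEpsNeck`; (b): an `ε`-cap, each of whose points off a compact set lies in an
`ε`-neck — the cap `≅ 𝔹⁴`/`ℝP⁴∖𝔹̄⁴` is not compact, so such a point exists), OR `x` lies in a
compact open set on which `g(t)` has positive curvature operator (alternative (c)). This is the
`C^k` shadow of the tree's `chenZhu_aprioriAssumptions_smoothSolution` (C⁰ form; PROVED in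
`CanonicalNeighbourhoodTheorem.lean` from `chenZhu_canonicalNeighbourhoodTheorem` (Thm 4.1, C⁰
VENDORING — "to be split along these lines when the §3 vocabulary exists"),
`perelman_noLocalCollapsing`, `hamilton_chenZhu_pinching`,
`ricciFlow_preserves_positiveIsotropicCurvature`, `continuousOn_scalarCurvatureWith_family`); the
stub is the same 60-line plumbing over the `C^k` form of Thm 4.1, which has to be VENDORED (an
upgrade of an existing named fact to its printed strength, plus a `C^k` cap notion `IsCkEpsCap`;
planner-filed definition/cite items). A constant threshold `r` is weaker than the printed
non-increasing `r(t)`. [XL as literature, M as plumbing; THE BET OF THE LINE. Leans on: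
`IsMaximalRicciFlow`, `IsCkEpsNeck`, `IsCkStrongEpsNeck.isCkEpsNeck`, `HasPositiveCurvatureOperatorOn`,
`HasCanonicalNeighbourhood` (template), `exists_scalarCurvatureWith_le_of_family`.]
[cite: ChenZhu2006, Thm. 4.1 (p. 19), §5 p. 26, §2 p. 4, §4 p. 24] -/
theorem stub_ckDichotomy :
    ∃ ε₀ : ℝ, 0 < ε₀ ∧ ∀ ε : ℝ, 0 < ε → ε ≤ ε₀ →
      ∀ (M : Type) [TopologicalSpace M] [T2Space M] [SecondCountableTopology M] [CompactSpace M]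
        [ChartedSpace (EuclideanSpace ℝ (Fin 4)) M] [IsManifold (𝓡 4) ∞ M] [SimplyConnectedSpace M]
        (g : ℝ → PseudoRiemannianMetric (𝓡 4) ∞ (EuclideanSpace ℝ (Fin 4))
          (TangentSpace (𝓡 4) : M → Type _))
        (cov : ℝ → CovariantDerivative (𝓡 4) (EuclideanSpace ℝ (Fin 4))
          (TangentSpace (𝓡 4) : M → Type _)) (T : ℝ),
        IsMaximalRicciFlow g cov T → 1 < T → (g 0).HasPositiveIsotropicCurvature →
        ∃ r : ℝ, 0 < r ∧ ∀ t ∈ Ico 0 T, ∀ x : M,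
          r⁻¹ ^ 2 ≤ (g t).scalarCurvatureWith (cov t) x →
            (∃ (N : Set M) (r' : ℝ), IsCkEpsNeck 3 (g t) N ε r') ∨
            (∃ B : Set M, IsOpen B ∧ IsCompact B ∧ x ∈ B ∧
              HasPositiveCurvatureOperatorOn (g t) (cov t) B) := by
  sorry

/-- **stub_thirdAlternative** — THE EXCLUSION ARGUMENT (the line's own endgame logic, Chen–Zhu
2006 §5 alternative (c); card neck-exclusion): GIVEN the neck lemma, the propagation of `WP ≤ c₀`
along Ricci flows, and the `C^k` dichotomy, a closed simply connected Riemannian `4`-manifold with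
`R > 0` and `WP < 1/6` pointwise carries a Riemannian metric with positive curvature operator.
Proof route: `c₀ := max_M WP < 1/6` (compactness; `WP` continuous where `R > 0`); the maximal Ricci
flow from `g₀` exists (`ricciFlow_maximal_existence`; the immortal alternative is excluded and
`T ≤ 2/R_min` by `IsRicciFlow.singularTime_le`, PROVED); rescale parabolically so that `T > 1`
(`exists_isMaximalRicciFlow_one_lt_of_isMaximalRicciFlow`, PROVED; `WP` and `R > 0` are
scale-invariant: `weakPinching_constSmul`, `scalarCurvature_constSmul`); by the second hypothesis
`WP ≤ c₀` and `R > 0` on `[0, T)`; `WP < 1/6 ∧ R > 0 ⇒ PIC`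
(`sq_scalarCurvature_sub_three_mul_isotropicCurvature_le`: `(R − 3K)² ≤ 6|W|² ≤ 6c₀R² < R²`); fix
`δ := (1/6 − c₀)/2`, `ε := min ε₀ (ε₁ δ)` and get `r` from the third hypothesis; curvature blows
up (`ricciFlow_curvature_blowup`; `|Rm|² = |W|² + 2|E|² + R²/6 ≤ (c₀ + 1/6)R²`, so some `(x, t)`
has `R(x,t) ≥ r⁻²`); a `C^k` `ε`-neck in `(M, g t)` would contain `y` with
`WP(y) ≥ 1/6 − δ > c₀` — contradiction; so `x` lies in a compact open `B` with positive curvature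
operator, `B = M` (clopen, nonempty, `M` connected), and `g t` has positive curvature operator for
its (unique) Levi-Civita connection (`hasPositiveCurvatureOperatorOn_univ_iff`,
`IsLeviCivita.eq_leviCivita_holds`). [M/L modulo `ricciFlow_maximal_existence` and
`ricciFlow_curvature_blowup` (both reduced in the tree to `ricciFlow_shortTime_existence` (+
`ricciFlow_uniqueness`)).] [cite: ChenZhu2006, §5, p. 26 (c)] [cite: Margerin1998, Thm. 1] -/
theorem stub_thirdAlternative :
    -- (N) the neck lemma, `stub_neckWP` verbatim
    (∀ δ : ℝ, 0 < δ → ∃ ε₁ : ℝ, 0 < ε₁ ∧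
      ∀ (M : Type) [TopologicalSpace M] [T2Space M] [SecondCountableTopology M]
        [ChartedSpace (EuclideanSpace ℝ (Fin 4)) M] [IsManifold (𝓡 4) ∞ M]
        (g : PseudoRiemannianMetric (𝓡 4) ∞ (EuclideanSpace ℝ (Fin 4)) (TangentSpace (𝓡 4) : M → Type _))
        [g.HasLeviCivita], g.IsRiemannian →
        ∀ (N : Set M) (ε r : ℝ), ε ≤ ε₁ → IsCkEpsNeck 3 g N ε r →
          ∃ y ∈ N, 1 / 6 - δ ≤ g.weakPinching y) →
    -- (P) propagation of `WP ≤ c₀`, the conclusion of `stub_wpPropagation` verbatim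
    (∀ (M : Type) [TopologicalSpace M] [T2Space M] [SecondCountableTopology M] [CompactSpace M]
      [ChartedSpace (EuclideanSpace ℝ (Fin 4)) M] [IsManifold (𝓡 4) ∞ M] (T : ℝ)
      (g : ℝ → PseudoRiemannianMetric (𝓡 4) ∞ (EuclideanSpace ℝ (Fin 4))
        (TangentSpace (𝓡 4) : M → Type _))
      (cov : ℝ → CovariantDerivative (𝓡 4) (EuclideanSpace ℝ (Fin 4))
        (TangentSpace (𝓡 4) : M → Type _)),
      IsRicciFlow g cov (Ico 0 T) → (∀ t ∈ Ico 0 T, (g t).IsRiemannian) →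
      ∀ c₀ : ℝ, 0 ≤ c₀ → c₀ < 1 / 6 →
      (∀ x : M, haveI := (g 0).hasLeviCivita; 0 < (g 0).scalarCurvature x) →
      (∀ x : M, haveI := (g 0).hasLeviCivita; (g 0).weakPinching x ≤ c₀) →
      ∀ t ∈ Ico 0 T, ∀ x : M, haveI := (g t).hasLeviCivita;
        0 < (g t).scalarCurvature x ∧ (g t).weakPinching x ≤ c₀) →
    -- (D) the `C^k` dichotomy, `stub_ckDichotomy` verbatim
    (∃ ε₀ : ℝ, 0 < ε₀ ∧ ∀ ε : ℝ, 0 < ε → ε ≤ ε₀ →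
      ∀ (M : Type) [TopologicalSpace M] [T2Space M] [SecondCountableTopology M] [CompactSpace M]
        [ChartedSpace (EuclideanSpace ℝ (Fin 4)) M] [IsManifold (𝓡 4) ∞ M] [SimplyConnectedSpace M]
        (g : ℝ → PseudoRiemannianMetric (𝓡 4) ∞ (EuclideanSpace ℝ (Fin 4))
          (TangentSpace (𝓡 4) : M → Type _))
        (cov : ℝ → CovariantDerivative (𝓡 4) (EuclideanSpace ℝ (Fin 4))
          (TangentSpace (𝓡 4) : M → Type _)) (T : ℝ),
        IsMaximalRicciFlow g cov T → 1 < T → (g 0).HasPositiveIsotropicCurvature →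
        ∃ r : ℝ, 0 < r ∧ ∀ t ∈ Ico 0 T, ∀ x : M,
          r⁻¹ ^ 2 ≤ (g t).scalarCurvatureWith (cov t) x →
            (∃ (N : Set M) (r' : ℝ), IsCkEpsNeck 3 (g t) N ε r') ∨
            (∃ B : Set M, IsOpen B ∧ IsCompact B ∧ x ∈ B ∧
              HasPositiveCurvatureOperatorOn (g t) (cov t) B)) →
    -- conclusion: Margerin's hypotheses on a closed simply connected `M⁴` give a PCO metric
    ∀ (M : Type) [TopologicalSpace M] [T2Space M] [SecondCountableTopology M]
      [ChartedSpace (EuclideanSpace ℝ (Fin 4)) M] [IsManifold (𝓡 4) ∞ M] [CompactSpace M]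
      [SimplyConnectedSpace M]
      (g₀ : PseudoRiemannianMetric (𝓡 4) ∞ (EuclideanSpace ℝ (Fin 4)) (TangentSpace (𝓡 4) : M → Type _))
      [g₀.HasLeviCivita], g₀.IsRiemannian → (∀ x, 0 < g₀.scalarCurvature x) →
      (∀ x, g₀.weakPinching x < 1 / 6) →
      ∃ g₁ : PseudoRiemannianMetric (𝓡 4) ∞ (EuclideanSpace ℝ (Fin 4)) (TangentSpace (𝓡 4) : M → Type _),
        g₁.IsRiemannian ∧ g₁.HasPositiveCurvatureOperator := by
  sorry

/-- **stub_hamiltonConvergence** — HAMILTON 1986, THE CONVERGENCE HALF (H1) of Thm. 1.1 (J.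
Differential Geom. 24, p. 154 with criterion 5.2 and Thm. 7.1: on a compact 4-manifold with
positive curvature operator the normalised Ricci flow "exists for all time and converges … to a
metric of constant Riemannian curvature"): every closed connected smooth `4`-manifold carrying a
`C^∞` Riemannian metric of positive curvature operator carries a `C^∞` Riemannian metric of
constant sectional curvature `c > 0`. VERBATIM the hypothesis `h₁` of the tree's reduction
`hamilton_positiveCurvatureOperator_classification_four_of_constantCurvature`
(`HamiltonPCOClassificationKillingHopf.lean`; the other half (H2) Killing–Hopf is PROVED there,
`killingHopf_quotient_four`), through which the composition recovers the named fact
`hamilton_positiveCurvatureOperator_classification_four` (`S⁴ ∨ ℝP⁴`). Shared debt with routes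
ExoticMirrors / AngleDefectCertificates and with the sibling cards' node "criterion 5.2 (H1)".
[XL citation leaf: Hamilton's pinching family for PCO (ODE layer PROVED in the tree,
`RicciFlowPositiveCurvatureOperator.lean` / `isInvariant_pcoPinchingFive`), tensor maximum
principle, §5.2 convergence criterion (interpolation, Hamilton 1982 §§10–17).]
[cite: Hamilton1986, §1, Thm. 1.1 (p. 153) and p. 154, §5 (5.2)] -/
theorem stub_hamiltonConvergence :
    ∀ (M : Type) [TopologicalSpace M] [T2Space M] [SecondCountableTopology M]
      [CompactSpace M] [ConnectedSpace M] [ChartedSpace (EuclideanSpace ℝ (Fin 4)) M]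
      [IsManifold (𝓡 4) ∞ M],
      (∃ g : PseudoRiemannianMetric (𝓡 4) ∞ (EuclideanSpace ℝ (Fin 4))
          (TangentSpace (𝓡 4) : M → Type _), g.IsRiemannian ∧ g.HasPositiveCurvatureOperator) →
        ∃ (c : ℝ) (g' : PseudoRiemannianMetric (𝓡 4) ∞ (EuclideanSpace ℝ (Fin 4))
          (TangentSpace (𝓡 4) : M → Type _)),
          0 < c ∧ g'.IsRiemannian ∧ g'.HasConstantSectionalCurvature c := by
  sorry

/-! ## Composition (real proofs; no `sorry` below this line) -/

/-- **Margerin's leaf, simply connected case, along this line**: `R > 0` and `WP < 1/6` on a closed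
simply connected `M⁴` give `M ≅ S⁴` — neck exclusion (`stub_thirdAlternative` fed with
`stub_neckWP`, `stub_wpPropagation stub_coneInvariant`, `stub_ckDichotomy`) produces a metric of
positive curvature operator, Hamilton 1986 — convergence (H1) = `stub_hamiltonConvergence`, plus
Killing–Hopf (H2), PROVED (`hamilton_positiveCurvatureOperator_classification_four_of_constantCurvature`)
— gives `S⁴ ∨ ℝP⁴`, and `π₁ = 1` discards `ℝP⁴`
(`hamilton_positiveCurvatureOperator_sphere_four_of_classification`, tree).
[cite: Margerin1998, Thm. 1] [cite: Hamilton1986, Thm. 1.1] -/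
theorem margerin_sphere_of_simplyConnected
    (M : Type) [TopologicalSpace M] [T2Space M] [SecondCountableTopology M]
    [ChartedSpace (EuclideanSpace ℝ (Fin 4)) M] [IsManifold (𝓡 4) ∞ M] [CompactSpace M]
    [SimplyConnectedSpace M]
    (g : PseudoRiemannianMetric (𝓡 4) ∞ (EuclideanSpace ℝ (Fin 4)) (TangentSpace (𝓡 4) : M → Type _))
    [g.HasLeviCivita] (hg : g.IsRiemannian) (hR : ∀ x, 0 < g.scalarCurvature x)
    (hWP : ∀ x, g.weakPinching x < 1 / 6) :
    Nonempty (M ≃ₘ⟮𝓡 4, 𝓡 4⟯ 𝕊⁴) :=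
  hamilton_positiveCurvatureOperator_sphere_four_of_classification
    (hamilton_positiveCurvatureOperator_classification_four_of_constantCurvature
      stub_hamiltonConvergence) M
    (stub_thirdAlternative stub_neckWP (stub_wpPropagation stub_coneInvariant) stub_ckDichotomy
      M g hg hR hWP)

/-- **The crux along line `neck-exclusion`** (CGY 2003 §2 verbatim up to Margerin's leaf, which is
replaced by `margerin_sphere_of_simplyConnected`): `stub_pointwisePinching` gives a Riemannian `g'`
with `R > 0` and `¼|W|² < σ₂(A)` in every orthonormal frame; "rearranging terms"
(`IsOrthonormalFrame.weakPinching_of_sigma2_sub_pos`, `weakPinching_lt_iff`, tree) this is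
`WP < 1/6` pointwise; then neck exclusion. Concludes `EntropyRung.ChangGurskyYang` BY NAME.
[cite: ChangGurskyYang2003, §2, p. 121] -/
theorem ChangGurskyYang_of : Summit.SmoothPoincare4.SmoothPoincare4.Theses.EntropyRung.ChangGurskyYang := by
  rintro M _ _ _ _ _ _ _ ⟨g, _, hgR, hscal, hW⟩
  -- §1 (Thm. 1.4, α = 1) with CGB: a metric with `σ₂(A) - ¼|W|² > 0` in every orthonormal frame
  obtain ⟨g', _, hg'R, hscal', hpt⟩ := stub_pointwisePinching M g hgR hscal hW
  have hE : Module.finrank ℝ (EuclideanSpace ℝ (Fin 4)) = 4 := finrank_euclideanSpace_fin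
  have hpos' : ∀ (x : M) (v : TangentSpace (𝓡 4) x), v ≠ 0 → 0 < g'.val x v v :=
    fun x v hv ↦ hg'R x v hv
  -- "rearranging terms": weak pinching `< 1/6` pointwise
  have hWP : ∀ x, g'.weakPinching x < 1 / 6 := fun x ↦
    (g'.weakPinching_lt_iff hE (hpos' x) (hscal' x).ne').2 fun e he ↦
      he.weakPinching_of_sigma2_sub_pos g' (WithTop.coe_le_coe.mpr le_top) hE (hpt x e he)
  -- neck exclusion + Hamilton 1986 + `π₁ = 1`
  exact margerin_sphere_of_simplyConnected M g' hg'R hscal' hWP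

/-- **The same item as a decl of route WeylBudget** (rank 9; `WeylBudget.ChangGurskyYang` is the identical
text, `Disproof.weylBudget_crux_iff : … ↔ … := Iff.rfl`): the skeleton closes it too, BY NAME, so that
`ledger skeleton check` passes whichever of the two wanting routes it resolves the crux decl to.
[cite: ChangGurskyYang2003, Thm. A] -/
theorem WeylBudget_ChangGurskyYang_of :
    Summit.SmoothPoincare4.SmoothPoincare4.Theses.WeylBudget.ChangGurskyYang :=
  ChangGurskyYang_of

/-! ## Calibration (kernel): the round cylinder sits outside every cone the line uses

The neck family `(⅓·1, b·1, ⅓·1)` (`t = tr A = 1`; the round `S³ × ℝ` at `b = ⅓`, cf.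
`IdeasSketchR1K2.neckBlocks`) has traceless mass `6b²`, so it lies in `margerinCone k` iff
`6b² ≤ k`: the cylinder (`6/9 = 2/3`) is on the boundary of the `1/6`-cone and OUTSIDE `C(k)` for
every `k < 2/3` — the block-space form of the exclusion margin `1/6 − c₀ > 0` that
`stub_wpPropagation` transports and `stub_neckWP` cashes in. -/

/-- The neck family through the round cylinder `S³ × ℝ` (`b = ⅓`), normalised to `tr A = 1`. -/
def neckBlocks (b : ℝ) : Blocks :=
  ((1 / 3 : ℝ) • (1 : Matrix (Fin 3) (Fin 3) ℝ), b • (1 : Matrix (Fin 3) (Fin 3) ℝ),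
    (1 / 3 : ℝ) • (1 : Matrix (Fin 3) (Fin 3) ℝ))

/-- `‖M̊‖² = 6b²` along the neck family. [folklore] -/
theorem tracelessMass_neckBlocks (b : ℝ) : tracelessMass (neckBlocks b) = 6 * b ^ 2 := by
  simp [tracelessMass, neckBlocks, frob, Matrix.trace, Matrix.smul_apply, Matrix.one_apply,
    Matrix.sub_apply]
  ring

/-- The neck family meets `margerinCone k` exactly in `6b² ≤ k`. [folklore] -/
theorem neckBlocks_mem_margerinCone_iff (k b : ℝ) :
    neckBlocks b ∈ margerinCone k ↔ 6 * b ^ 2 ≤ k := by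
  have h1 : ((1 / 3 : ℝ) • (1 : Matrix (Fin 3) (Fin 3) ℝ)).IsSymm := by
    simp [Matrix.IsSymm]
  have htr : ((1 / 3 : ℝ) • (1 : Matrix (Fin 3) (Fin 3) ℝ)).trace = 1 := by
    simp [Matrix.trace]
  have hmass : tracelessMass (neckBlocks b) ≤ k * (neckBlocks b).1.trace ^ 2 ↔ 6 * b ^ 2 ≤ k := by
    rw [tracelessMass_neckBlocks, show (neckBlocks b).1.trace = 1 from htr, one_pow, mul_one]
  constructor
  · exact fun h ↦ hmass.1 h.2.2.2.2
  · intro h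
    refine ⟨h1, h1, rfl, ?_, hmass.2 h⟩
    show 0 ≤ ((1 / 3 : ℝ) • (1 : Matrix (Fin 3) (Fin 3) ℝ)).trace
    rw [htr]
    exact zero_le_one

/-- **The round cylinder is outside every cone `C(k)`, `k < 2/3`** (and on `∂C(2/3)`): in block
form, `WP(S³ × ℝ) = 1/6 > c₀`. [cite: Margerin1998, Part I, p. 27] -/
theorem roundCylinder_not_mem_margerinCone {k : ℝ} (hk : k < 2 / 3) :
    neckBlocks (1 / 3) ∉ margerinCone k := by
  rw [neckBlocks_mem_margerinCone_iff]
  norm_num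
  linarith

/-- … while it lies on the closed `1/6`-cone `C(2/3)` (the contact ray of
`IdeasSketchR1K2.rigidRays_contact`). [cite: Margerin1998, Prop. 28] -/
theorem roundCylinder_mem_margerinCone_twoThirds : neckBlocks (1 / 3) ∈ margerinCone (2 / 3) := by
  rw [neckBlocks_mem_margerinCone_iff]
  norm_num

/-! ## Sanity (kernel): the crux decl is the Literature fact verbatim; the two landed Negative
lemmas of the Disproof are in scope and concern statements none of the stubs instantiate. -/

example : Summit.SmoothPoincare4.SmoothPoincare4.Theses.EntropyRung.ChangGurskyYang ↔
    changGurskyYang_sphere_four := Iff.rfl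

example := @Summit.SmoothPoincare4.SmoothPoincare4.Theorems.ChangGurskyYang.Negative.changGurskyYang_false_without_compact
example := @Summit.SmoothPoincare4.SmoothPoincare4.Theorems.ChangGurskyYang.Negative.changGurskyYang_false_without_simplyConnected

end Summit.SmoothPoincare4.SmoothPoincare4.Cruxes.ChangGurskyYang.NeckExclusion

end
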